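import Literature.MathematicalPhysics.QuantumLattice.HeisenbergClusterProductUpperBound
import Literature.MathematicalPhysics.QuantumLattice.LiebMattisSectorPF
import Literature.MathematicalPhysics.QuantumLattice.SpinChainsLiebMattisProofs
import HarnessLib

/-!
# The columnar-dimer upper bound for the spin-½ Heisenberg antiferromagnet on the square lattice:
`e ≤ -3J/8`

Topic `MathematicalPhysics/QuantumLattice`; the `d = 2` companion of `HeisenbergChainDimerBound.lean`
and a second fully kernel-checked instance (no program-checked input) of the cluster-product upper
bound of `HeisenbergClusterProductUpperBound.lean`, now through the square-torus wrapper
`heisenbergSquareTorus_groundEnergy_le_of_clusterTrialEnergy_le` with the `2 × 1` cluster: the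
product of singlets on the columnar dimers `{(2j, y), (2j+1, y)}` of `(ℤ/Lℤ)²` (`L` even, `L ≥ 4`).
Each dimer carries `-3J/4`; every bond leaving a dimer has mean-field expectation
`⟨Sᶻ_x⟩⟨Sᶻ_y⟩ = 0` because *each* site of a singlet has `⟨Sᶻ_x⟩ = 0`. Hence

* `heisenbergSquareTorus_groundEnergy_le_dimer` — `E₀(H_L) ≤ -(3J/8)·L²` (`J ≥ 0`, `2 ∣ L`, `L ≥ 4`);
* `heisenbergEnergyDensity_two_le_dimer` — `e(½, d = 2, J) ≤ -3J/8`, and with the tree's Anderson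
  lower bound `heisenbergEnergyDensity_spinHalf_ge_anderson` (`-3/4 ≤ e` at `J = 1`,
  [cite: Anderson1951]) the bracket `heisenbergEnergyDensity_two_mem_Icc : e(1, 2, 1) ∈ [-3/4, -3/8]`
  (reference value from quantum Monte Carlo: `-0.6694`, Sandvik 1997 — not used).

The two-site singlet algebra is done here for an ARBITRARY two-point site type (`TwoSiteSinglet`, sites
`a ≠ b` with `∀ x, x = a ∨ x = b`), by the same highest-weight argument as in the chain file
(`Ŝ⁺u = 0` in the sector `Sᶻ_tot = 0` ⇒ `(𝐒_tot)²u = 0` ⇒ `⟨u, 𝐒_a·𝐒_b u⟩ = -¾‖u‖²`), plus the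
site-wise `⟨u, Sᶻ_a u⟩ = ⟨u, Sᶻ_b u⟩ = 0`; the chain file's `HeisenbergDimer` lemmas are its special
case `Λ = ℤ/2ℤ`. Dimer (valence-bond) states: A. Auerbach, *Interacting Electrons and Quantum
Magnetism* (Springer, 1994), §8.2, eq. (8.12); the bound is textbook folklore. No named facts.
-/

noncomputable section

open Matrix Complex Finset Filter Topology Literature.Probability.LatticeModels
open scoped ComplexOrder BigOperators

namespace Literature.MathematicalPhysics.QuantumLattice

/-! ### The singlet on an arbitrary two-point site type -/

namespace TwoSiteSinglet

open LiebMattis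

variable {Λ : Type*} [Fintype Λ] [DecidableEq Λ] {a b : Λ}

omit [DecidableEq Λ] in
/-- Sums over a two-point type. [folklore] -/
theorem sum_pair (hab : a ≠ b) (hall : ∀ x, x = a ∨ x = b) {β : Type*} [AddCommMonoid β] (f : Λ → β) :
    ∑ x, f x = f a + f b := by
  refine Fintype.sum_eq_add a b hab fun c hc => ?_
  rcases hall c with h | h
  · exact absurd h hc.1
  · exact absurd h hc.2

/-- A two-point type has two elements. [folklore] -/
theorem card_eq_two (hab : a ≠ b) (hall : ∀ x, x = a ∨ x = b) : Fintype.card Λ = 2 := by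
  have h : (Finset.univ : Finset Λ) = {a, b} := by
    ext x
    simp only [Finset.mem_univ, Finset.mem_insert, Finset.mem_singleton, true_iff]
    exact hall x
  rw [← Finset.card_univ, h, Finset.card_pair hab]

omit [Fintype Λ] [DecidableEq Λ] in
/-- A spin-½ configuration on a two-point type is determined by its two values. [folklore] -/
theorem cfg_eq_iff (hall : ∀ x, x = a ∨ x = b) (σ τ : TensorIndex Λ 2) :
    σ = τ ↔ σ a = τ a ∧ σ b = τ b := by
  constructor
  · rintro rfl
    exact ⟨rfl, rfl⟩
  · rintro ⟨h0, h1⟩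
    funext x
    rcases hall x with h | h
    · rw [h, h0]
    · rw [h, h1]

/-- The configuration `|↑_a ↓_b⟩` (`k = 0` is spin up). [folklore] -/
def cfgUD (a : Λ) : TensorIndex Λ 2 := fun x => if x = a then 0 else 1

/-- The configuration `|↓_a ↑_b⟩`. [folklore] -/
def cfgDU (a : Λ) : TensorIndex Λ 2 := fun x => if x = a then 1 else 0

omit [Fintype Λ] in
/-- Values of `|↑_a ↓_b⟩`. [folklore] -/
theorem cfgUD_apply (hab : a ≠ b) : cfgUD a a = 0 ∧ cfgUD a b = 1 := by
  refine ⟨if_pos rfl, ?_⟩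
  show (if b = a then (0 : Fin 2) else 1) = 1
  rw [if_neg (Ne.symm hab)]

omit [Fintype Λ] in
/-- Values of `|↓_a ↑_b⟩`. [folklore] -/
theorem cfgDU_apply (hab : a ≠ b) : cfgDU a a = 1 ∧ cfgDU a b = 0 := by
  refine ⟨if_pos rfl, ?_⟩
  show (if b = a then (1 : Fin 2) else 0) = 0
  rw [if_neg (Ne.symm hab)]

omit [Fintype Λ] in
/-- `|↑_a ↓_b⟩ ≠ |↓_a ↑_b⟩`. [folklore] -/
theorem cfgUD_ne_cfgDU (a : Λ) : cfgUD a ≠ cfgDU a := by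
  intro h
  have h1 := congrFun h a
  simp [cfgUD, cfgDU] at h1

/-- The (unnormalised) singlet `u = |↑_a ↓_b⟩ - |↓_a ↑_b⟩` (Auerbach (1994) eq. (8.12)). [folklore] -/
def vec (a b : Λ) : TensorIndex Λ 2 → ℂ := fun σ =>
  if σ a = 0 ∧ σ b = 1 then 1 else if σ a = 1 ∧ σ b = 0 then -1 else 0

omit [Fintype Λ] in
/-- `u(|↑_a ↓_b⟩) = 1`. [folklore] -/
theorem vec_cfgUD (hab : a ≠ b) : vec a b (cfgUD a) = 1 := by
  unfold vec
  rw [if_pos (cfgUD_apply hab)]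

omit [Fintype Λ] in
/-- `u(|↓_a ↑_b⟩) = -1`. [folklore] -/
theorem vec_cfgDU (hab : a ≠ b) : vec a b (cfgDU a) = -1 := by
  unfold vec
  rw [if_neg, if_pos (cfgDU_apply hab)]
  rw [(cfgDU_apply hab).1]
  exact fun h => Fin.zero_ne_one h.1.symm

omit [DecidableEq Λ] in
/-- The singlet is supported on the weight-one configurations (`Sᶻ_tot = 0`). [folklore] -/
theorem weight_eq_one_of_vec_ne_zero (hab : a ≠ b) (hall : ∀ x, x = a ∨ x = b) {σ : TensorIndex Λ 2}
    (h : vec a b σ ≠ 0) : (∑ x, (σ x : ℕ)) = 1 := by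
  rw [sum_pair hab hall]
  unfold vec at h
  split_ifs at h with h1 h2
  · rw [h1.1, h1.2]; rfl
  · rw [h2.1, h2.2]; rfl
  · exact absurd rfl h

omit [Fintype Λ] in
/-- The singlet vanishes off `|↑↓⟩, |↓↑⟩`. [folklore] -/
theorem vec_eq_zero_of_ne (hab : a ≠ b) (hall : ∀ x, x = a ∨ x = b) {σ : TensorIndex Λ 2}
    (h1 : σ ≠ cfgUD a) (h2 : σ ≠ cfgDU a) : vec a b σ = 0 := by
  unfold vec
  rw [Ne, cfg_eq_iff hall, (cfgUD_apply hab).1, (cfgUD_apply hab).2] at h1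
  rw [Ne, cfg_eq_iff hall, (cfgDU_apply hab).1, (cfgDU_apply hab).2] at h2
  rw [if_neg h1, if_neg h2]

/-- `‖u‖² = 2`. [folklore] -/
theorem star_vec_dotProduct (hab : a ≠ b) (hall : ∀ x, x = a ∨ x = b) :
    star (vec a b) ⬝ᵥ vec a b = 2 := by
  rw [dotProduct, Fintype.sum_eq_add (cfgUD a) (cfgDU a) (cfgUD_ne_cfgDU a)]
  · simp only [Pi.star_apply, vec_cfgUD hab, vec_cfgDU hab]
    norm_num
  · intro σ hσ
    rw [Pi.star_apply, vec_eq_zero_of_ne hab hall hσ.1 hσ.2, mul_zero]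

/-- The magnetisation of the singlet's sector is `|Λ|·n/2 - W = 2/2 - 1 = 0`. [folklore] -/
theorem sectorValue_eq_zero (hab : a ≠ b) (hall : ∀ x, x = a ∨ x = b) :
    ((Fintype.card Λ * 1 : ℕ) : ℝ) / 2 - (1 : ℕ) = 0 := by
  rw [card_eq_two hab hall]
  norm_num

/-- The singlet lies in the sector `Sᶻ_tot = 0`. [folklore] -/
theorem vec_mem_spinZSector (hab : a ≠ b) (hall : ∀ x, x = a ∨ x = b) :
    vec a b ∈ spinZSector (Λ := Λ) 1 (((Fintype.card Λ * 1 : ℕ) : ℝ) / 2 - (1 : ℕ)) := by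
  rw [mem_spinZSector_weight_iff]
  intro σ hσ
  by_contra h
  exact hσ (weight_eq_one_of_vec_ne_zero hab hall h)

/-- **The singlet is a highest-weight vector**: `Ŝ⁺_tot u = 0`. [folklore] -/
theorem raise_mulVec_vec (hab : a ≠ b) (hall : ∀ x, x = a ∨ x = b) :
    (totalSpin 1 0 + I • totalSpin 1 1 : Op Λ 2) *ᵥ vec a b = 0 := by
  funext σ
  rw [raise_mulVec_apply, sum_pair hab hall, sum_spinRaise_apply_mul, sum_spinRaise_apply_mul,
    Pi.zero_apply]
  have hupd0 : ∀ l : Fin 2, Function.update σ a l b = σ b := fun l => Function.update_of_ne (Ne.symm hab) l σ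
  have hupd1 : ∀ l : Fin 2, Function.update σ b l a = σ a := fun l => Function.update_of_ne hab l σ
  have h01 : ∀ l : Fin 2, l = 0 ∨ l = 1 := by decide
  rcases h01 (σ a) with h0 | h0 <;> rcases h01 (σ b) with h1 | h1 <;>
    simp [vec, h0, h1, hupd0, hupd1, Function.update_self]

/-- `(𝐒_tot)² u = 0`. [folklore] -/
theorem totalSpinSq_mulVec_vec (hab : a ≠ b) (hall : ∀ x, x = a ∨ x = b) :
    (totalSpinSq 1 : Op Λ 2) *ᵥ vec a b = 0 := by
  rw [totalSpinSq_mulVec_of_raise_eq_zero 1 (vec_mem_spinZSector hab hall) (raise_mulVec_vec hab hall),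
    sectorValue_eq_zero hab hall]
  simp

/-- On two sites `Sᵅ_tot = Sᵅ_a + Sᵅ_b`. [folklore] -/
theorem totalSpin_eq (hab : a ≠ b) (hall : ∀ x, x = a ∨ x = b) (α : Fin 3) :
    (totalSpin 1 α : Op Λ 2) = siteSpin 1 a α + siteSpin 1 b α := by
  unfold totalSpin
  exact sum_pair hab hall _

/-- On two sites `(𝐒_tot)² = 2(S(S+1)·1 + 𝐒_a·𝐒_b)` (cf. Auerbach (1994) eq. (8.16)). [folklore] -/
theorem totalSpinSq_eq (hab : a ≠ b) (hall : ∀ x, x = a ∨ x = b) :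
    (totalSpinSq 1 : Op Λ 2) = (2 : ℂ) • (((casimirValue 1 : ℝ) : ℂ) • (1 : Op Λ 2) + spinDot 1 a b) := by
  unfold totalSpinSq
  simp only [totalSpin_eq hab hall]
  exact sum_siteSpin_add_mul_self 1 hab

/-- **The singlet bond energy**: `⟨u, 𝐒_a·𝐒_b u⟩ = -3/2 = -¾‖u‖²`. [folklore] -/
theorem star_vec_dotProduct_spinDot (hab : a ≠ b) (hall : ∀ x, x = a ∨ x = b) :
    star (vec a b) ⬝ᵥ (spinDot 1 a b *ᵥ vec a b) = -(3 / 2 : ℂ) := by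
  have h := congrArg (fun v => star (vec a b) ⬝ᵥ v) (totalSpinSq_mulVec_vec hab hall)
  simp only [dotProduct_zero] at h
  rw [totalSpinSq_eq hab hall, smul_mulVec, add_mulVec, smul_mulVec, one_mulVec, dotProduct_smul,
    dotProduct_add, dotProduct_smul, star_vec_dotProduct hab hall, casimirValue] at h
  push_cast at h
  simp only [smul_eq_mul] at h
  linear_combination h / 2

/-- `Sᶻ_x` acts diagonally: `(Sᶻ_x v)(σ) = (n/2 - σ_x) v(σ)`. [folklore] -/
theorem siteSpin_two_mulVec_apply (n : ℕ) (x : Λ) (v : TensorIndex Λ (n + 1) → ℂ)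
    (σ : TensorIndex Λ (n + 1)) :
    ((siteSpin n x 2 : Op Λ (n + 1)) *ᵥ v) σ = ((n : ℂ) / 2 - ((σ x : ℕ) : ℂ)) * v σ := by
  rw [mulVec, dotProduct, Finset.sum_eq_single σ]
  · rw [siteSpin_two_apply, if_pos rfl]
  · intro τ _ hτ
    rw [siteSpin_two_apply, if_neg (Ne.symm hτ), zero_mul]
  · intro h
    exact absurd (Finset.mem_univ σ) h

/-- **Each site of a singlet is unpolarised**: `⟨u, Sᶻ_a u⟩ = 0`. [folklore] -/
theorem star_vec_dotProduct_spinZ_left (hab : a ≠ b) (hall : ∀ x, x = a ∨ x = b) :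
    star (vec a b) ⬝ᵥ (siteSpin 1 a 2 *ᵥ vec a b) = 0 := by
  rw [dotProduct, Fintype.sum_eq_add (cfgUD a) (cfgDU a) (cfgUD_ne_cfgDU a)]
  · simp only [Pi.star_apply, siteSpin_two_mulVec_apply, vec_cfgUD hab, vec_cfgDU hab,
      (cfgUD_apply hab).1, (cfgDU_apply hab).1]
    norm_num
  · intro σ hσ
    rw [Pi.star_apply, vec_eq_zero_of_ne hab hall hσ.1 hσ.2, star_zero, zero_mul]

/-- **Each site of a singlet is unpolarised**: `⟨u, Sᶻ_b u⟩ = 0`. [folklore] -/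
theorem star_vec_dotProduct_spinZ_right (hab : a ≠ b) (hall : ∀ x, x = a ∨ x = b) :
    star (vec a b) ⬝ᵥ (siteSpin 1 b 2 *ᵥ vec a b) = 0 := by
  rw [dotProduct, Fintype.sum_eq_add (cfgUD a) (cfgDU a) (cfgUD_ne_cfgDU a)]
  · simp only [Pi.star_apply, siteSpin_two_mulVec_apply, vec_cfgUD hab, vec_cfgDU hab,
      (cfgUD_apply hab).2, (cfgDU_apply hab).2]
    norm_num
  · intro σ hσ
    rw [Pi.star_apply, vec_eq_zero_of_ne hab hall hσ.1 hσ.2, star_zero, zero_mul]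

/-! ### The normalised singlet -/

/-- The normalised singlet `φ = u/√2`. [folklore] -/
def state (a b : Λ) : TensorIndex Λ 2 → ℂ := ((Real.sqrt 2)⁻¹ : ℂ) • vec a b

/-- `(1/√2)·(1/√2)·2 = 1` in `ℂ`, with `star`. [folklore] -/
theorem star_invSqrtTwo_mul : star ((Real.sqrt 2)⁻¹ : ℂ) * ((Real.sqrt 2)⁻¹ : ℂ) = 1 / 2 := by
  rw [Complex.star_def, ← Complex.ofReal_inv, Complex.conj_ofReal, ← Complex.ofReal_mul, ← mul_inv,
    Real.mul_self_sqrt (by norm_num : (0 : ℝ) ≤ 2)]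
  norm_num

/-- `‖φ‖ = 1`. [folklore] -/
theorem star_state_dotProduct (hab : a ≠ b) (hall : ∀ x, x = a ∨ x = b) :
    star (state a b) ⬝ᵥ state a b = 1 := by
  rw [state, star_smul, smul_dotProduct, dotProduct_smul, smul_smul, star_vec_dotProduct hab hall,
    smul_eq_mul, star_invSqrtTwo_mul]
  norm_num

omit [DecidableEq Λ] in
/-- `φ` is supported on the weight-one configurations. [folklore] -/
theorem state_sector (hab : a ≠ b) (hall : ∀ x, x = a ∨ x = b) (σ : TensorIndex Λ 2)
    (h : state a b σ ≠ 0) : (∑ x, (σ x : ℕ)) = 1 := by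
  refine weight_eq_one_of_vec_ne_zero hab hall fun h0 => h ?_
  rw [state, Pi.smul_apply, h0, smul_zero]

/-- Bond energy of the normalised singlet: `Re⟨φ, 𝐒_a·𝐒_b φ⟩ = -3/4`. [folklore] -/
theorem re_expect_spinDot_state (hab : a ≠ b) (hall : ∀ x, x = a ∨ x = b) :
    (star (state a b) ⬝ᵥ (spinDot 1 a b *ᵥ state a b)).re = -(3 / 4 : ℝ) := by
  rw [state, star_smul, mulVec_smul, smul_dotProduct, dotProduct_smul, smul_smul,
    star_vec_dotProduct_spinDot hab hall, smul_eq_mul, star_invSqrtTwo_mul]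
  norm_num

/-- `Re⟨φ, Sᶻ_a φ⟩ = 0`. [folklore] -/
theorem re_expect_spinZ_left_state (hab : a ≠ b) (hall : ∀ x, x = a ∨ x = b) :
    (star (state a b) ⬝ᵥ (siteSpin 1 a 2 *ᵥ state a b)).re = 0 := by
  rw [state, star_smul, mulVec_smul, smul_dotProduct, dotProduct_smul, smul_smul,
    star_vec_dotProduct_spinZ_left hab hall, smul_zero, Complex.zero_re]

/-- `Re⟨φ, Sᶻ_b φ⟩ = 0`. [folklore] -/
theorem re_expect_spinZ_right_state (hab : a ≠ b) (hall : ∀ x, x = a ∨ x = b) :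
    (star (state a b) ⬝ᵥ (siteSpin 1 b 2 *ᵥ state a b)).re = 0 := by
  rw [state, star_smul, mulVec_smul, smul_dotProduct, dotProduct_smul, smul_smul,
    star_vec_dotProduct_spinZ_right hab hall, smul_zero, Complex.zero_re]

end TwoSiteSinglet

/-! ### The `2 × 1` cluster of the square torus -/

namespace HeisenbergColumnarDimer

open HeisenbergTL LiebMattis TwoSiteSinglet

/-- The left site `(0, 0)` of the `2 × 1` cluster `ℤ/2ℤ × ℤ/1ℤ`. [folklore] -/
def x0 : RectTorusSite ![2, 1] := fun _ => 0

/-- The right site `(1, 0) = (0, 0) + e₀` of the `2 × 1` cluster. [folklore] -/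
def x1 : RectTorusSite ![2, 1] := x0 + Pi.single (0 : Fin 2) 1

/-- `(0,0) ≠ (1,0)`. [folklore] -/
theorem x0_ne_x1 : x0 ≠ x1 := by decide

/-- Every site of `ℤ/2ℤ × ℤ/1ℤ` is `(0,0)` or `(1,0)` (four-element check). [folklore] -/
theorem eq_x0_or_eq_x1 : ∀ x : RectTorusSite ![2, 1], x = x0 ∨ x = x1 := by decide

/-- `(1,0) + e₀ = (0,0)` in `ℤ/2ℤ × ℤ/1ℤ`. [folklore] -/
theorem x1_add_single : x1 + Pi.single (0 : Fin 2) 1 = x0 := by decide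

/-- The left site is interior in direction `0`: `0 + 1 < 2`. [folklore] -/
theorem x0_interior : (x0 0).val + 1 < ![2, 1] 0 := by decide

/-- The right site is on the boundary in direction `0`: `¬ (1 + 1 < 2)`. [folklore] -/
theorem x1_boundary : ¬ ((x1 0).val + 1 < ![2, 1] 0) := by decide

/-- Every site is on the boundary in direction `1` (side length `1`). [folklore] -/
theorem boundary_one : ∀ x : RectTorusSite ![2, 1], ¬ ((x 1).val + 1 < ![2, 1] 1) := by decide

/-- The columnar-dimer block state: the normalised singlet on the `2 × 1` cluster. [folklore] -/
def dimerState : TensorIndex (RectTorusSite ![2, 1]) 2 → ℂ := state x0 x1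

/-- **The trial energy of the `2 × 1` cluster is `-3/4`**: the bond inside the dimer gives `-3/4`, every
boundary mean-field term contains a factor `Re⟨φ, Sᶻ_x φ⟩ = 0`. [folklore] -/
theorem clusterTrialEnergy_dimerState_le : clusterTrialEnergy 1 ![2, 1] dimerState ≤ -(3 / 4 : ℝ) := by
  unfold clusterTrialEnergy
  rw [sum_pair x0_ne_x1 eq_x0_or_eq_x1, Fin.sum_univ_two, Fin.sum_univ_two]
  simp only [clusterBondTerm_eq_of_sector 1 ![2, 1] dimerState (state_sector x0_ne_x1 eq_x0_or_eq_x1)]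
  rw [if_pos x0_interior, if_neg x1_boundary, if_neg (boundary_one x0), if_neg (boundary_one x1), dimerState,
    re_expect_spinZ_left_state x0_ne_x1 eq_x0_or_eq_x1, re_expect_spinZ_right_state x0_ne_x1 eq_x0_or_eq_x1]
  rw [show x0 + Pi.single (0 : Fin 2) 1 = x1 from rfl, re_expect_spinDot_state x0_ne_x1 eq_x0_or_eq_x1]
  norm_num

/-- The block state is normalised. [folklore] -/
theorem star_dimerState_dotProduct : star dimerState ⬝ᵥ dimerState = 1 :=
  star_state_dotProduct x0_ne_x1 eq_x0_or_eq_x1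

end HeisenbergColumnarDimer

open HeisenbergColumnarDimer HeisenbergTL

/-- **The columnar-dimer bound for the Heisenberg square torus**: for spin `½`, `J ≥ 0` and every even
`L ≥ 4`, `E₀(J Σ_{⟨xy⟩} 𝐒_x·𝐒_y on (ℤ/Lℤ)²) ≤ -(3J/8)·L²` — the product of singlets on the columnar
dimers is a trial state with energy `-3J/4` per dimer and vanishing inter-dimer terms. An instance of
`heisenbergSquareTorus_groundEnergy_le_of_clusterTrialEnergy_le` (`2 × 1` cluster) with no numerical
input; dimer states as in Auerbach (1994) §8.2. [folklore] -/
theorem heisenbergSquareTorus_groundEnergy_le_dimer {J : ℝ} (hJ : 0 ≤ J) (L : ℕ) [NeZero L]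
    (hdvd : 2 ∣ L) (hL : 4 ≤ L) :
    (heisenbergHamiltonian 1 (torusGraph 2 L) J).groundEnergy ≤ -(3 * J / 8) * (L : ℝ) ^ 2 := by
  have hq : J * clusterTrialEnergy 1 ![2, 1] dimerState ≤ -(3 * J / 8) * (2 : ℕ) * (1 : ℕ) := by
    have h := mul_le_mul_of_nonneg_left clusterTrialEnergy_dimerState_le hJ
    push_cast
    linarith
  exact heisenbergSquareTorus_groundEnergy_le_of_clusterTrialEnergy_le 1 J (a := 2) (b := 1) le_rfl
    dimerState star_dimerState_dotProduct hq L hdvd (one_dvd L) (by omega) (by omega)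

/-- **The dimer (valence-bond) upper bound for the square lattice in the thermodynamic limit**: for spin
`½` and `J ≥ 0`, `e(1, 2, J) = lim_L E₀(H_L)/L² ≤ -3J/8` (`heisenbergEnergyDensity_le_clusterProduct` with
the `2 × 1` cluster). [folklore] -/
theorem heisenbergEnergyDensity_two_le_dimer {J : ℝ} (hJ : 0 ≤ J) :
    heisenbergEnergyDensity 1 2 J ≤ -(3 * J / 8) := by
  have h := heisenbergEnergyDensity_le_clusterProduct 1 (by norm_num : 1 ≤ 2) hJ ![2, 1] dimerState
    star_dimerState_dotProduct
  rw [Fin.prod_univ_two] at h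
  have h2 := mul_le_mul_of_nonneg_left clusterTrialEnergy_dimerState_le hJ
  have h3 : J * clusterTrialEnergy 1 ![2, 1] dimerState / (((![2, 1] 0 : ℕ) : ℝ) * ((![2, 1] 1 : ℕ) : ℝ))
      ≤ -(3 * J / 8) := by
    simp only [Matrix.cons_val_zero, Matrix.cons_val_one, Matrix.cons_val_fin_one]
    push_cast
    rw [mul_one, div_le_iff₀ (by norm_num : (0 : ℝ) < 2)]
    linarith
  exact h.trans h3

/-- The bracket at `J = 1` for the square lattice: `-3/4 ≤ e ≤ -3/8`, both halves kernel-checked (lower: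
Anderson's bound [cite: Anderson1951]; upper: the columnar dimer state). [folklore] -/
theorem heisenbergEnergyDensity_two_mem_Icc :
    heisenbergEnergyDensity 1 2 1 ∈ Set.Icc (-(3 / 4 : ℝ)) (-(3 / 8 : ℝ)) := by
  refine ⟨?_, ?_⟩
  · have h := heisenbergEnergyDensity_spinHalf_ge_anderson (d := 2) (by norm_num)
    norm_num at h ⊢
    exact h
  · have h := heisenbergEnergyDensity_two_le_dimer (J := 1) zero_le_one
    norm_num at h ⊢
    exact h

end Literature.MathematicalPhysics.QuantumLattice

end
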